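import Mathlib
import Literature.NumberTheory.LFunctions.Zhang2022.Section16Eq1610Numeric
import HarnessLib

/-!
# Zhang (2022), §16 (16.10): the remainder bookkeeping with a GENERIC decay exponent `X`

Topic `Literature/NumberTheory/LFunctions/Zhang2022` (Landau–Siegel audit tree; verdict-neutral).
Y. Zhang, *Discrete mean estimates and the Landau–Siegel zero*, arXiv:2211.02515v1 (2022)
[Zhang2022LandauSiegel] — **an unrefereed manuscript under adjudication**; nothing here asserts its
Theorems 1–2. Companion of `Section16Eq1610Numeric` (zl-w16-p5): there the left-segment saving is wired to
`(d/P₄)^η ≤ e^{−18ηL^{1.1}}`, which is the range `dl < P₂² = PT⁻²⁰` printed in (16.10) [Z22 p.92, tex L4550].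
The consumer of (16.10) — the insertion into (16.5)/(16.12), `Typed.Section16A.eq16_12_of_eq16_5P_of_eq16_10_weighted`
— needs `dl` on the whole support of `b₁`, `dl < 2T²P^{1/2}max(P₂,P₃) = 2PT⁻⁸`, where only
`(d/P₄)^η ≤ e^{−η(6L^{1.1} + …)}` is available. This real-arithmetic file therefore restates the two lemmas
with the decay as a free parameter `X` (`(d/P₄)^η ≤ e^{−X}` against `L²⁰²⁰ ≤ e^{X}`), proofs verbatim
otherwise: `left_le_X`, `numeric_bound_X` (the printed-range versions are the instances `X = (9c/4)L^{1/10}`).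

## References

* Y. Zhang, arXiv:2211.02515v1 (2022), §16 (16.10) p.92. [cite: Zhang2022LandauSiegel, §16 (16.10) p.92]
-/

noncomputable section

open Real

namespace Literature.NumberTheory.LFunctions.Zhang2022.Eq1610

/-- **Left segment, generic decay**: as `left_le`, with the saving supplied as `(d/P₄)^η ≤ e^{−X}` and
`L²⁰²⁰ ≤ e^{X}`. [cite: Zhang2022LandauSiegel, §16 (16.10) p.92] -/
theorem left_le_X {L η Bζ Minv KM P dd cL CL Cζ X : ℝ} (hL : 1 ≤ L) (hη0 : 0 < η) (hη1 : η ≤ 1)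
    (hηlow : cL / (8 * L) ≤ η) (hcL : 0 < cL) (hBζ0 : 0 ≤ Bζ) (hBζL : Bζ ≤ Cζ * L)
    (hCζ : 0 < Cζ) (hMinv0 : 0 < Minv) (hMinvL : Minv ≤ 2 * (CL + 1) * L) (hCL : 0 ≤ CL)
    (hKM : 0 ≤ KM) (hP1 : 1 ≤ P) (hdd1 : 1 ≤ dd)
    (hdX : (dd / P) ^ η ≤ Real.exp (-X)) (hG : L ^ (2020 : ℝ) ≤ Real.exp X) :
    1 / (2 * π) * ((η⁻¹ + Bζ) * KM * Bζ * (Minv * (1 + 2 / η)) * dd ^ η *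
      (P ^ (-η) * rexp ((-η) ^ 2 / (4 * L ^ 30)) / |(-η)|) * Real.sqrt (4 * π * L ^ 30)) ≤
      KM * (1 / (2 * π) * ((8 / cL + Cζ) * Cζ * (2 * (CL + 1)) * (1 + 16 / cL) * (24 / cL) * 4)) *
        (L ^ 2000)⁻¹ := by
  have hL0 : 0 < L := by linarith
  have hπ := Real.pi_pos
  have hP0 : 0 < P := by linarith
  have hdd0 : 0 ≤ dd := by linarith
  have hsqrt := sqrt_four_pi_pow_le hL0.le
  have hexpη : rexp ((-η) ^ 2 / (4 * L ^ 30)) ≤ 3 := by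
    refine (Real.exp_le_exp.mpr ?_).trans (by have := Real.exp_one_lt_d9; linarith)
    rw [div_le_one (by positivity)]
    have h1 : (-η) ^ 2 ≤ 1 := by
      rw [neg_sq, sq]
      calc η * η ≤ 1 * 1 := mul_le_mul hη1 hη1 hη0.le zero_le_one
        _ = 1 := one_mul 1
    have : 1 ≤ L ^ 30 := one_le_pow₀ hL
    linarith
  -- `η⁻¹ ≤ 8L/c`
  have hηinv : η⁻¹ ≤ 8 * L / cL := by
    have h8 : 0 < cL / (8 * L) := by positivity
    calc η⁻¹ ≤ (cL / (8 * L))⁻¹ := inv_anti₀ h8 hηlow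
      _ = 8 * L / cL := by rw [inv_div]
  -- the decay (hypothesis)
  have hdecay : (dd / P) ^ η ≤ Real.exp (-X) := hdX
  have hL20 : L ^ 20 * Real.exp (-X) ≤ (L ^ 2000)⁻¹ := by
    have h2020 : L ^ (2020 : ℝ) = L ^ 20 * L ^ 2000 := by norm_cast; ring
    rw [h2020] at hG
    have hexp0 : 0 < Real.exp X := Real.exp_pos _
    calc L ^ 20 * Real.exp (-X) = (L ^ 20 * L ^ 2000) / Real.exp X / L ^ 2000 := by
          rw [Real.exp_neg]; field_simp
      _ ≤ Real.exp X / Real.exp X / L ^ 2000 := by gcongr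
      _ = (L ^ 2000)⁻¹ := by rw [div_self hexp0.ne', one_div]
  -- the bracket `d^η (P^{-η} e₃ / η) ≤ e^{-X}·3·(8L/c)`
  have hratio : dd ^ η * P ^ (-η) = (dd / P) ^ η := by
    rw [Real.div_rpow hdd0 hP0.le, Real.rpow_neg hP0.le, div_eq_mul_inv]
  have habsη : |(-η)| = η := by rw [abs_neg, abs_of_pos hη0]
  have hbr : dd ^ η * (P ^ (-η) * rexp ((-η) ^ 2 / (4 * L ^ 30)) / |(-η)|) ≤
      Real.exp (-X) * 3 * (8 * L / cL) := by
    rw [habsη]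
    have hrw : dd ^ η * (P ^ (-η) * rexp ((-η) ^ 2 / (4 * L ^ 30)) / η) =
        (dd ^ η * P ^ (-η)) * rexp ((-η) ^ 2 / (4 * L ^ 30)) * η⁻¹ := by
      rw [div_eq_mul_inv]; ring
    rw [hrw, hratio]
    have h0 : 0 ≤ (dd / P) ^ η := Real.rpow_nonneg (div_nonneg hdd0 hP0.le) _
    have hexp0 : 0 ≤ Real.exp (-X) := (Real.exp_pos _).le
    exact mul_le_mul (mul_le_mul hdecay hexpη (Real.exp_pos _).le hexp0) hηinv
      (inv_pos.mpr hη0).le (by positivity)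
  -- the other factors
  have hf1 : η⁻¹ + Bζ ≤ (8 / cL + Cζ) * L := by
    have h1 : 8 * L / cL = 8 / cL * L := by ring
    have h2 : (8 / cL + Cζ) * L = 8 / cL * L + Cζ * L := by ring
    rw [h1] at hηinv; rw [h2]; linarith
  have hf2 : 1 + 2 / η ≤ (1 + 16 / cL) * L := by
    have h2η : 2 / η ≤ 16 * L / cL := by
      rw [div_eq_mul_inv]
      calc 2 * η⁻¹ ≤ 2 * (8 * L / cL) := by linarith
        _ = 16 * L / cL := by ring
    have : (1 + 16 / cL) * L = L + 16 * L / cL := by ring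
    rw [this]; linarith
  have hf0 : 0 ≤ η⁻¹ + Bζ := by positivity
  have hbr0 : 0 ≤ dd ^ η * (P ^ (-η) * rexp ((-η) ^ 2 / (4 * L ^ 30)) / |(-η)|) := by
    rw [habsη]; positivity
  have hsqrt0 : 0 ≤ Real.sqrt (4 * π * L ^ 30) := Real.sqrt_nonneg _
  calc 1 / (2 * π) * ((η⁻¹ + Bζ) * KM * Bζ * (Minv * (1 + 2 / η)) * dd ^ η *
        (P ^ (-η) * rexp ((-η) ^ 2 / (4 * L ^ 30)) / |(-η)|) * Real.sqrt (4 * π * L ^ 30))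
      = 1 / (2 * π) * ((η⁻¹ + Bζ) * KM * Bζ * (Minv * (1 + 2 / η)) *
          (dd ^ η * (P ^ (-η) * rexp ((-η) ^ 2 / (4 * L ^ 30)) / |(-η)|)) *
          Real.sqrt (4 * π * L ^ 30)) := by ring
    _ ≤ 1 / (2 * π) * (((8 / cL + Cζ) * L) * KM * (Cζ * L) * ((2 * (CL + 1) * L) *
          ((1 + 16 / cL) * L)) * (Real.exp (-X) * 3 * (8 * L / cL)) * (4 * L ^ 15)) := by
        gcongr 1 / (2 * π) * (?_ * KM * ?_ * (?_ * ?_) * ?_ * ?_)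
    _ = KM * (1 / (2 * π) * ((8 / cL + Cζ) * Cζ * (2 * (CL + 1)) * (1 + 16 / cL) * (24 / cL) * 4)) *
          (L ^ 20 * Real.exp (-X)) := by
        field_simp; ring
    _ ≤ KM * (1 / (2 * π) * ((8 / cL + Cζ) * Cζ * (2 * (CL + 1)) * (1 + 16 / cL) * (24 / cL) * 4)) *
          (L ^ 2000)⁻¹ := by gcongr

/-- **The whole remainder, generic decay**: as `numeric_bound`, with `(d/P₄)^η ≤ e^{−X}`, `L²⁰²⁰ ≤ e^{X}`
in place of the printed-range instance. [cite: Zhang2022LandauSiegel, §16 (16.10) p.92] -/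
theorem numeric_bound_X {L η H Bζ Minv KM ρ b1 b2 P dd g cL CL Cζ K₅ X : ℝ} (hL : 64 ≤ L)
    (hη0 : 0 < η) (hη1 : η ≤ 1) (hηlow : cL / (8 * L) ≤ η) (hcL : 0 < cL) (hH : H = L ^ 20)
    (hBζ0 : 0 ≤ Bζ) (hBζL : Bζ ≤ Cζ * L) (hCζ : 0 < Cζ) (hMinv0 : 0 < Minv)
    (hMinvL : Minv ≤ 2 * (CL + 1) * L) (hCL : 0 ≤ CL) (hKM : 0 ≤ KM) (hρ1 : ρ < 1)
    (hρK : 1 - ρ ≤ K₅ * (L ^ 2022)⁻¹) (hK₅ : 0 < K₅) (hb1l : π / L ^ 9 / 2 ≤ b1)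
    (hb2l : π / L ^ 9 ≤ b2) (hb2u : b2 < 1) (hP1 : 1 ≤ P) (hPle : P ≤ Real.exp (L ^ 9) * L ^ 519)
    (hdd1 : 1 ≤ dd) (hddle : dd ≤ Real.exp (L ^ 9))
    (hdX : (dd / P) ^ η ≤ Real.exp (-X)) (hg0 : 0 ≤ g)
    (hgb : L ^ 2600 * Real.exp (2 * L ^ 9 + 2) * g ≤ 1)
    (hG : L ^ (2020 : ℝ) ≤ Real.exp X) :
    1 / (2 * π) *
        (2 * (8 * KM * (P ^ (1 : ℝ) * rexp ((1 : ℝ) ^ 2 / (4 * L ^ 30)) / |(1 : ℝ)|) *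
            (g * (Real.sqrt (4 * π * L ^ 30) / 2))) +
          (η⁻¹ + Bζ) * KM * Bζ * (Minv * (1 + 2 / η)) * dd ^ η *
            (P ^ (-η) * rexp ((-η) ^ 2 / (4 * L ^ 30)) / |(-η)|) *
            Real.sqrt (4 * π * L ^ 30) +
          2 * ((1 - -η) * ((1 + Bζ) * KM * Bζ * (Minv * 3) * dd ^ (1 : ℝ) *
            (max (P ^ (-η)) (P ^ (1 : ℝ)) * rexp (max ((-η) ^ 2) ((1 : ℝ) ^ 2) / (4 * L ^ 30)) *
              g / (H - |b2|))))) +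
      Minv * (b1⁻¹ + Bζ) * KM * (2 * (1 - ρ)) * Real.exp 1 * (Real.exp 1 / b2) ≤
      KM * (48 / π +
        1 / (2 * π) * ((8 / cL + Cζ) * Cζ * (2 * (CL + 1)) * (1 + 16 / cL) * (24 / cL) * 4) +
        36 * (1 + Cζ) * Cζ * (CL + 1) / π +
        2 * (CL + 1) * (2 / π + Cζ) * (2 * K₅) * 3 * (3 / π)) * (L ^ 2000)⁻¹ := by
  have hL1 : 1 ≤ L := by linarith
  have hL0 : 0 < L := by linarith
  have hα0 : 0 < π / L ^ 9 := by positivity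
  have hb2 : 0 < b2 := by linarith
  have hT1 := tails_le hL1 hKM hP1 hPle hg0 hgb
  have hT2 := left_le_X hL1 hη0 hη1 hηlow hcL hBζ0 hBζL hCζ hMinv0 hMinvL hCL hKM hP1 hdd1 hdX hG
  have hT3 := horiz_le hL hη0 hη1 hH hBζ0 hBζL hCζ hMinv0 hMinvL hCL hKM hb2 hb2u hP1 hPle hdd1
    hddle hg0 hgb
  have hT4 := exc_le hL1 hBζ0 hBζL hCζ hMinvL hCL hKM hρ1 hρK hK₅ hb1l hb2l
  rw [mul_add (1 / (2 * π)), mul_add (1 / (2 * π))]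
  linarith only [hT1, hT2, hT3, hT4]

end Literature.NumberTheory.LFunctions.Zhang2022.Eq1610
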